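import Summits.BirchSwinnertonDyer.BirchSwinnertonDyer.Theorems.ResidualThetaTransportAtTwoThetaLayerLambdaCongruenceAtTwoPeriodHom
import Mathlib.Analysis.Normed.Group.Ultra
import Mathlib.Analysis.Normed.Field.Basic
import HarnessLib

/-!
# Crux `ThetaLayerLambdaCongruenceAtTwo` (stmt-BirchSwinnertonDyer-20688, route ResidualThetaTransportAtTwo), line
# `birth`, stub (C3)/(C3k) — ITEM A, part 3: `T₂` IS THE IDENTITY ON THE PERIODS AT ORDER-4 ELLIPTIC ELEMENTS
# (elliptic half of the Eisenstein/elliptic exclusion) (lead prover bsd-wall-rtt-p3 g3;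
# `--supports stmt-BirchSwinnertonDyer-20688 --as helper`; closes nothing)

HONEST FRAMING. Elementary THEOREMS about functions `Φ : ℚ → R` only; nothing about any curve or form is asserted;
BSD is not proved by any of this. Piece (P3, elliptic half) of `Cruxes/ThetaLayerLambdaCongruenceAtTwo/Lines/birth-C3-plan.md`.

WHAT. For a Γ₀(N)-symbol function `Φ : ℚ → R` (Manin's relation, inline as in (C3)) with period homomorphism
`per_Φ(γ) = Φ(γ·∞)` (`…PeriodHom`: a homomorphism `Γ₀(N) → R` killing parabolics), `N` ODD, and an elliptic element
`γ = (a, b; c, −a) ∈ Γ₀(N)` of order `4` (trace `0`; these exist iff `−1` is a square mod `N`):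
  `(T₂Φ)(γ·∞) = Φ(a/(2c)) + Φ((a+c)/(2c)) + Φ(2a/c) = Φ(a/c) = per_Φ(γ)`   (`heckeTwo_apply_maninCusp_of_trace_zero`),
EXACTLY, over any additive group. Mechanism (Merel's transfer formula made explicit): writing the three `T₂`-matrices
`δ₁ = (1,0;0,2)`, `δ₂ = (1,1;0,2)`, `δ₃ = (2,0;0,1)`, one has `δ_i γ = γ_i δ_{σ(i)}` with `γ_i ∈ Γ₀(N)`; since `γ`
acts on the three index-`2` sublattices of the CM lattice `ℤ[i]` with ONE fixed line (`(1+i)`) and ONE `2`-cycle,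
`σ` has one fixed point `i₀` and one transposition `(j k)`; `γ_j γ_k = δ_j γ² δ_j⁻¹ = −1` so `per(γ_j) + per(γ_k) = 0`,
and `γ_{i₀} = g γ g⁻¹` with the EXPLICIT `g = δ_{i₀}(1 + γ)/2 ∈ Γ₀(N)` (the endomorphism `1 + i` preserves the
Γ₀(N)-structure), so `per(γ_{i₀}) = per(γ)`. Three parity cases: `a` even (`i₀ = 2`), `a` odd & `b` even (`i₀ = 1`),
`a` odd & `c` even (`i₀ = 3`).
CONSEQUENCE (`maninCusp_eq_zero_of_trace_zero_of_heckeTwo`, `norm_maninCusp_lt_one_of_trace_zero`): if `T₂Φ ≡ λΦ` modulo a subgroup `S` then `(1 − λ)·per_Φ(γ) ∈ S`; for a NON-UNIT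
eigenvalue (`‖λ‖ < 1`, e.g. `λ = a₂(W)` with `W` supersingular at `2`; or `λ = 0` exactly) the period homomorphism of
`Φ` KILLS every order-`4` elliptic element modulo `𝔪`. Together with `…PeriodHom` (parabolics; order-`3`/`6` elements die
in characteristic `2` for free since `3·per = 0`) and `…TwoExclusion` (injectivity): the `𝔪`-eigen symbol functions of
(C3k) inject into `Hom(H₁(X₀(N'); ℤ), k̄) = H¹(X₀(N'), k̄)` — ITEM A of the plan is complete in function currency.
NOT here: the comparison with `H₁(X₀(N'))` as an object, multiplicity one itself.

References: [Merel1994] §1.2–1.3, Prop. 4 (Hecke operators on Manin symbols via `Σ u_i γ = γ_i u_{σ i}`);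
[Manin1972] §1.5–1.7; [CremonaAlgorithms1997] §2.4; [DiamondShurman2005] §3.7 (elliptic points of `Γ₀(N)`), §5.2.
-/

noncomputable section

-- justification: the `Summit.BirchSwinnertonDyer.BirchSwinnertonDyer.…` path repeats a component (route-file convention)
set_option linter.dupNamespace false

open scoped Classical MatrixGroups

open CongruenceSubgroup

namespace Summit.BirchSwinnertonDyer.BirchSwinnertonDyer.Theorems.ThetaLayerLambdaCongruenceAtTwo

/-! ## §1. Tools: explicit elements of `Γ₀(N)`, conjugation invariance and pair cancellation of periods -/

section Tools

variable {R : Type*} [AddCommGroup R] {N : ℕ} {Φ : ℚ → R}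

/-- An integer matrix `(p, q; r, s)` with `ps − qr = 1` and `N ∣ r` is an element of `Γ₀(N)` with these entries.
[folklore] -/
theorem exists_gamma0_entries (p q r s : ℤ) (hdet : p * s - q * r = 1) (hr : (N : ℤ) ∣ r) :
    ∃ γ : Gamma0 N, (γ : SL(2, ℤ)) 0 0 = p ∧ (γ : SL(2, ℤ)) 0 1 = q ∧ (γ : SL(2, ℤ)) 1 0 = r ∧
      (γ : SL(2, ℤ)) 1 1 = s := by
  let M : SL(2, ℤ) := ⟨!![p, q; r, s], by rw [Matrix.det_fin_two_of]; linear_combination hdet⟩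
  have hM : M ∈ Gamma0 N := by
    rw [Gamma0_mem]
    show ((r : ℤ) : ZMod N) = 0
    obtain ⟨t, rfl⟩ := hr
    push_cast
    simp
  exact ⟨⟨M, hM⟩, rfl, rfl, rfl, rfl⟩

/-- **Conjugation invariance of periods**: if `g γ = γ' g` in `Γ₀(N)` then `Φ(γ'·∞) = Φ(γ·∞)` (the period map is a
homomorphism to an abelian group, `maninCusp_mul`). [cite: Manin1972, §1.5 and Thm. 1.9] -/
theorem maninCusp_eq_of_conj
    (hM : ∀ (γ : Gamma0 N) (r : ℚ), ((γ : SL(2, ℤ)) 1 0 : ℚ) * r + ((γ : SL(2, ℤ)) 1 1 : ℚ) ≠ 0 →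
      Φ ((((γ : SL(2, ℤ)) 0 0 : ℚ) * r + ((γ : SL(2, ℤ)) 0 1 : ℚ)) /
        (((γ : SL(2, ℤ)) 1 0 : ℚ) * r + ((γ : SL(2, ℤ)) 1 1 : ℚ))) =
        (if ((γ : SL(2, ℤ)) 1 0) = 0 then 0 else Φ ((((γ : SL(2, ℤ)) 0 0 : ℚ)) / (((γ : SL(2, ℤ)) 1 0 : ℚ)))) + Φ r)
    (g γ γ' : Gamma0 N) (h : g * γ = γ' * g) :
    (if ((γ' : SL(2, ℤ)) 1 0) = 0 then 0 else Φ ((((γ' : SL(2, ℤ)) 0 0 : ℚ)) / (((γ' : SL(2, ℤ)) 1 0 : ℚ)))) =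
      (if ((γ : SL(2, ℤ)) 1 0) = 0 then 0 else Φ ((((γ : SL(2, ℤ)) 0 0 : ℚ)) / (((γ : SL(2, ℤ)) 1 0 : ℚ)))) := by
  have h1 := maninCusp_mul hM g γ
  have h2 := maninCusp_mul hM γ' g
  rw [h] at h1
  rw [h1] at h2
  -- `h2 : per γ' + per g = per g + per γ`
  exact add_right_cancel (h2.symm.trans (add_comm _ _))

/-- **Pair cancellation**: if `p₁ p₂` fixes `∞` (lower-left entry `0`, e.g. `p₁ p₂ = ±1`) then
`Φ(p₁·∞) + Φ(p₂·∞) = 0`. [cite: Manin1972, §1.5 and Thm. 1.9] -/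
theorem maninCusp_add_eq_zero_of_mul_apply_eq_zero
    (hM : ∀ (γ : Gamma0 N) (r : ℚ), ((γ : SL(2, ℤ)) 1 0 : ℚ) * r + ((γ : SL(2, ℤ)) 1 1 : ℚ) ≠ 0 →
      Φ ((((γ : SL(2, ℤ)) 0 0 : ℚ) * r + ((γ : SL(2, ℤ)) 0 1 : ℚ)) /
        (((γ : SL(2, ℤ)) 1 0 : ℚ) * r + ((γ : SL(2, ℤ)) 1 1 : ℚ))) =
        (if ((γ : SL(2, ℤ)) 1 0) = 0 then 0 else Φ ((((γ : SL(2, ℤ)) 0 0 : ℚ)) / (((γ : SL(2, ℤ)) 1 0 : ℚ)))) + Φ r)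
    (p₁ p₂ : Gamma0 N) (h : ((p₁ * p₂ : Gamma0 N) : SL(2, ℤ)) 1 0 = 0) :
    (if ((p₁ : SL(2, ℤ)) 1 0) = 0 then 0 else Φ ((((p₁ : SL(2, ℤ)) 0 0 : ℚ)) / (((p₁ : SL(2, ℤ)) 1 0 : ℚ)))) +
      (if ((p₂ : SL(2, ℤ)) 1 0) = 0 then 0 else Φ ((((p₂ : SL(2, ℤ)) 0 0 : ℚ)) / (((p₂ : SL(2, ℤ)) 1 0 : ℚ)))) = 0 := by
  have h1 := maninCusp_mul hM p₁ p₂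
  rw [if_pos h] at h1
  exact h1.symm

/-- The lower-left entry of a product in `Γ₀(N)`: `(γδ)₁₀ = γ₁₀ δ₀₀ + γ₁₁ δ₁₀`. [folklore] -/
theorem gamma0_mul_apply_one_zero (γ δ : Gamma0 N) :
    ((γ * δ : Gamma0 N) : SL(2, ℤ)) 1 0 =
      (γ : SL(2, ℤ)) 1 0 * (δ : SL(2, ℤ)) 0 0 + (γ : SL(2, ℤ)) 1 1 * (δ : SL(2, ℤ)) 1 0 :=
  (Matrix.two_mul_expl ((γ : SL(2, ℤ)) : Matrix (Fin 2) (Fin 2) ℤ)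
    ((δ : SL(2, ℤ)) : Matrix (Fin 2) (Fin 2) ℤ)).2.2.1

/-- Equality in `Γ₀(N)` from equality of the four entries. [folklore] -/
theorem gamma0_ext {γ δ : Gamma0 N} (h00 : (γ : SL(2, ℤ)) 0 0 = (δ : SL(2, ℤ)) 0 0)
    (h01 : (γ : SL(2, ℤ)) 0 1 = (δ : SL(2, ℤ)) 0 1) (h10 : (γ : SL(2, ℤ)) 1 0 = (δ : SL(2, ℤ)) 1 0)
    (h11 : (γ : SL(2, ℤ)) 1 1 = (δ : SL(2, ℤ)) 1 1) : γ = δ := by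
  apply Subtype.ext
  ext i j
  fin_cases i <;> fin_cases j
  · exact h00
  · exact h01
  · exact h10
  · exact h11

/-- `g γ = γ' g` in `Γ₀(N)` from the eight entry products. [folklore] -/
theorem gamma0_mul_eq_mul_of_entries (g γ γ' : Gamma0 N)
    (h00 : (g : SL(2, ℤ)) 0 0 * (γ : SL(2, ℤ)) 0 0 + (g : SL(2, ℤ)) 0 1 * (γ : SL(2, ℤ)) 1 0 =
      (γ' : SL(2, ℤ)) 0 0 * (g : SL(2, ℤ)) 0 0 + (γ' : SL(2, ℤ)) 0 1 * (g : SL(2, ℤ)) 1 0)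
    (h01 : (g : SL(2, ℤ)) 0 0 * (γ : SL(2, ℤ)) 0 1 + (g : SL(2, ℤ)) 0 1 * (γ : SL(2, ℤ)) 1 1 =
      (γ' : SL(2, ℤ)) 0 0 * (g : SL(2, ℤ)) 0 1 + (γ' : SL(2, ℤ)) 0 1 * (g : SL(2, ℤ)) 1 1)
    (h10 : (g : SL(2, ℤ)) 1 0 * (γ : SL(2, ℤ)) 0 0 + (g : SL(2, ℤ)) 1 1 * (γ : SL(2, ℤ)) 1 0 =
      (γ' : SL(2, ℤ)) 1 0 * (g : SL(2, ℤ)) 0 0 + (γ' : SL(2, ℤ)) 1 1 * (g : SL(2, ℤ)) 1 0)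
    (h11 : (g : SL(2, ℤ)) 1 0 * (γ : SL(2, ℤ)) 0 1 + (g : SL(2, ℤ)) 1 1 * (γ : SL(2, ℤ)) 1 1 =
      (γ' : SL(2, ℤ)) 1 0 * (g : SL(2, ℤ)) 0 1 + (γ' : SL(2, ℤ)) 1 1 * (g : SL(2, ℤ)) 1 1) :
    g * γ = γ' * g := by
  have e1 := Matrix.two_mul_expl ((g : SL(2, ℤ)) : Matrix (Fin 2) (Fin 2) ℤ)
    ((γ : SL(2, ℤ)) : Matrix (Fin 2) (Fin 2) ℤ)
  have e2 := Matrix.two_mul_expl ((γ' : SL(2, ℤ)) : Matrix (Fin 2) (Fin 2) ℤ)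
    ((g : SL(2, ℤ)) : Matrix (Fin 2) (Fin 2) ℤ)
  apply gamma0_ext
  · exact (e1.1.trans h00).trans e2.1.symm
  · exact (e1.2.1.trans h01).trans e2.2.1.symm
  · exact (e1.2.2.1.trans h10).trans e2.2.2.1.symm
  · exact (e1.2.2.2.trans h11).trans e2.2.2.2.symm

end Tools

/-! ## §2. `T₂` acts as the identity on the period at an elliptic element of order 4 -/

section Elliptic

variable {R : Type*} [AddCommGroup R] {N : ℕ} {Φ : ℚ → R}

/-- Bookkeeping: if `q₁, q₂, q₃ ∈ Γ₀(N)` carry `∞` to `x/2`, `(x+1)/2`, `2x` respectively, then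
`(T₂Φ)(x) = Φ(q₁·∞) + Φ(q₂·∞) + Φ(q₃·∞)`. [folklore] -/
theorem heckeTwo_apply_eq_maninCusp_add (x : ℚ) (q₁ q₂ q₃ : Gamma0 N)
    (h₁ : (q₁ : SL(2, ℤ)) 1 0 ≠ 0) (e₁ : (((q₁ : SL(2, ℤ)) 0 0 : ℚ)) / (((q₁ : SL(2, ℤ)) 1 0 : ℚ)) = x / 2)
    (h₂ : (q₂ : SL(2, ℤ)) 1 0 ≠ 0) (e₂ : (((q₂ : SL(2, ℤ)) 0 0 : ℚ)) / (((q₂ : SL(2, ℤ)) 1 0 : ℚ)) = (x + 1) / 2)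
    (h₃ : (q₃ : SL(2, ℤ)) 1 0 ≠ 0) (e₃ : (((q₃ : SL(2, ℤ)) 0 0 : ℚ)) / (((q₃ : SL(2, ℤ)) 1 0 : ℚ)) = 2 * x) :
    (∑ j : Fin 2, Φ ((x + j) / 2)) + Φ (2 * x) =
      (if ((q₁ : SL(2, ℤ)) 1 0) = 0 then 0 else Φ ((((q₁ : SL(2, ℤ)) 0 0 : ℚ)) / (((q₁ : SL(2, ℤ)) 1 0 : ℚ)))) +
      (if ((q₂ : SL(2, ℤ)) 1 0) = 0 then 0 else Φ ((((q₂ : SL(2, ℤ)) 0 0 : ℚ)) / (((q₂ : SL(2, ℤ)) 1 0 : ℚ)))) +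
      (if ((q₃ : SL(2, ℤ)) 1 0) = 0 then 0 else Φ ((((q₃ : SL(2, ℤ)) 0 0 : ℚ)) / (((q₃ : SL(2, ℤ)) 1 0 : ℚ)))) := by
  rw [if_neg h₁, if_neg h₂, if_neg h₃, e₁, e₂, e₃, Fin.sum_univ_two, Fin.val_zero, Nat.cast_zero, add_zero,
    Fin.val_one, Nat.cast_one]

/-- **`(T₂Φ)(γ·∞) = Φ(γ·∞)` for `γ ∈ Γ₀(N)` of trace zero** (`N` odd, `Φ` any Γ₀(N)-symbol function):
`Φ(a/(2c)) + Φ((a+c)/(2c)) + Φ(2a/c) = Φ(a/c)` for `γ = (a,b;c,−a) ∈ Γ₀(N)`. See the module docstring for the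
mechanism (one `T₂`-coset is fixed by `γ` and conjugate via the explicit `g = δ(1+γ)/2 ∈ Γ₀(N)`; the other two form
a pair with product `−1`). Stated in the `T₂`-shape of (C3): `Σ_{j<2} Φ((x+j)/2) + Φ(2x)` at `x = a/c`.
[cite: Merel1994, §1.2–1.3] -/
theorem heckeTwo_apply_maninCusp_of_trace_zero (hN : Odd N)
    (hM : ∀ (γ : Gamma0 N) (r : ℚ), ((γ : SL(2, ℤ)) 1 0 : ℚ) * r + ((γ : SL(2, ℤ)) 1 1 : ℚ) ≠ 0 →
      Φ ((((γ : SL(2, ℤ)) 0 0 : ℚ) * r + ((γ : SL(2, ℤ)) 0 1 : ℚ)) /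
        (((γ : SL(2, ℤ)) 1 0 : ℚ) * r + ((γ : SL(2, ℤ)) 1 1 : ℚ))) =
        (if ((γ : SL(2, ℤ)) 1 0) = 0 then 0 else Φ ((((γ : SL(2, ℤ)) 0 0 : ℚ)) / (((γ : SL(2, ℤ)) 1 0 : ℚ)))) + Φ r)
    (γ : Gamma0 N) (htr : (γ : SL(2, ℤ)) 1 1 = -((γ : SL(2, ℤ)) 0 0)) :
    (∑ j : Fin 2, Φ (((((γ : SL(2, ℤ)) 0 0 : ℚ)) / (((γ : SL(2, ℤ)) 1 0 : ℚ)) + j) / 2)) +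
        Φ (2 * ((((γ : SL(2, ℤ)) 0 0 : ℚ)) / (((γ : SL(2, ℤ)) 1 0 : ℚ)))) =
      Φ ((((γ : SL(2, ℤ)) 0 0 : ℚ)) / (((γ : SL(2, ℤ)) 1 0 : ℚ))) := by
  have hconj := fun g γ' h ↦ maninCusp_eq_of_conj hM g γ γ' h
  have hpair := fun p₁ p₂ h ↦ maninCusp_add_eq_zero_of_mul_apply_eq_zero hM p₁ p₂ h
  have hdet : (γ : SL(2, ℤ)) 0 0 * (γ : SL(2, ℤ)) 0 0 + (γ : SL(2, ℤ)) 0 1 * (γ : SL(2, ℤ)) 1 0 = -1 := by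
    have := Matrix.det_fin_two (γ : SL(2, ℤ)).1
    rw [(γ : SL(2, ℤ)).2] at this
    rw [htr] at this
    linear_combination this
  have hNc : (N : ℤ) ∣ (γ : SL(2, ℤ)) 1 0 := (ZMod.intCast_zmod_eq_zero_iff_dvd _ N).mp (Gamma0_mem.mp γ.2)
  obtain ⟨m, hm⟩ : Odd (N : ℤ) := hN.natCast
  have hc0 : (γ : SL(2, ℤ)) 1 0 ≠ 0 := by
    intro h
    rw [h, mul_zero, add_zero] at hdet
    nlinarith
  have hcQ : (((γ : SL(2, ℤ)) 1 0 : ℤ) : ℚ) ≠ 0 := by exact_mod_cast hc0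
  have three : ∀ u v w : R, u + v + w = v + (w + u) := fun u v w ↦ by abel
  rcases Int.even_or_odd ((γ : SL(2, ℤ)) 0 0) with ⟨a', ha'⟩ | ⟨a', ha'⟩
  · /- Case A: `a = 2a'` even; then `b = 2b'+1`, `c = 2c'+1` are odd. Fixed coset `δ₂` (`↦ (x+1)/2`); pair
      `p₂ = δ₁ γ δ₃⁻¹ ↦ x/2`, `p₁ = δ₃ γ δ₁⁻¹ ↦ 2x`. -/
    have hb_odd : Odd ((γ : SL(2, ℤ)) 0 1) := by
      rcases Int.even_or_odd ((γ : SL(2, ℤ)) 0 1) with ⟨t, ht⟩ | h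
      · exfalso; rw [ha', ht] at hdet
        have : (2 : ℤ) ∣ -1 := ⟨(a' + a') * a' + t * (γ : SL(2, ℤ)) 1 0, by linear_combination -hdet⟩
        omega
      · exact h
    have hc_odd : Odd ((γ : SL(2, ℤ)) 1 0) := by
      rcases Int.even_or_odd ((γ : SL(2, ℤ)) 1 0) with ⟨t, ht⟩ | h
      · exfalso; rw [ha', ht] at hdet
        have : (2 : ℤ) ∣ -1 := ⟨(a' + a') * a' + (γ : SL(2, ℤ)) 0 1 * t, by linear_combination -hdet⟩
        omega
      · exact h
    obtain ⟨b', hb'⟩ := hb_odd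
    obtain ⟨c', hc'⟩ := hc_odd
    rw [ha', hb', hc'] at hdet
    rw [hc'] at hNc
    have hdet2 : 2 * a' * a' + 2 * b' * c' + b' + c' + 1 = 0 := by linarith [hdet]
    -- fixed translate `γ₂ = δ₂ γ δ₂⁻¹` and conjugator `g = δ₂ (1 + γ)/2`
    obtain ⟨γ₂, e00, e01, e10, e11⟩ := exists_gamma0_entries (N := N) (a' + a' + (2 * c' + 1))
      (b' - (a' + a') - c') (2 * (2 * c' + 1)) (-(a' + a') - (2 * c' + 1))
      (by linear_combination (-1 : ℤ) * hdet) (Dvd.dvd.mul_left hNc 2)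
    obtain ⟨g, g00, g01, g10, g11⟩ := exists_gamma0_entries (N := N) (1 + a' + c') (b' + 1 - a') (2 * c' + 1)
      (1 - (a' + a')) (by linear_combination (-1 : ℤ) * hdet2) hNc
    have hgγ : g * γ = γ₂ * g := by
      apply gamma0_mul_eq_mul_of_entries <;>
        simp only [g00, g01, g10, g11, e00, e01, e10, e11, htr, ha', hb', hc'] <;> ring
    -- the pair
    obtain ⟨p₁, p00, p01, p10, p11⟩ := exists_gamma0_entries (N := N) (4 * a') (2 * b' + 1) (2 * c' + 1) (-a')
      (by linear_combination (-1 : ℤ) * hdet) hNc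
    obtain ⟨p₂, q00, q01, q10, q11⟩ := exists_gamma0_entries (N := N) a' (2 * b' + 1) (2 * c' + 1) (-(4 * a'))
      (by linear_combination (-1 : ℤ) * hdet) hNc
    have hprod : ((p₁ * p₂ : Gamma0 N) : SL(2, ℤ)) 1 0 = 0 := by
      rw [gamma0_mul_apply_one_zero, p10, p11, q00, q10]; ring
    -- assembly
    have E := heckeTwo_apply_eq_maninCusp_add (Φ := Φ)
      ((((γ : SL(2, ℤ)) 0 0 : ℚ)) / (((γ : SL(2, ℤ)) 1 0 : ℚ))) p₂ γ₂ p₁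
      (by rw [q10]; omega) (by rw [q00, q10, ha', hc']; push_cast; field_simp; ring)
      (by rw [e10]; omega) (by
        rw [e00, e10, ha', hc']
        have : ((2 * c' + 1 : ℤ) : ℚ) ≠ 0 := by rw [← hc']; exact hcQ
        push_cast at this ⊢; field_simp)
      (by rw [p10]; omega) (by rw [p00, p10, ha', hc']; push_cast; field_simp; ring)
    rw [E, hconj g γ₂ hgγ, if_neg hc0, three, hpair p₁ p₂ hprod, add_zero]
  · /- Case B: `a = 2a'+1` odd; then `bc ≡ 2 (mod 4)`. -/
    rcases Int.even_or_odd ((γ : SL(2, ℤ)) 0 1) with ⟨b', hb'⟩ | ⟨b', hb'⟩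
    · /- Case B1: `b = 2b'` even, `c = 2c'+1` odd. Fixed coset `δ₁` (`↦ x/2`); pair `δ₂ γ δ₃⁻¹ ↦ (x+1)/2`,
        `δ₃ γ δ₂⁻¹ ↦ 2x`. -/
      have hc_odd : Odd ((γ : SL(2, ℤ)) 1 0) := by
        rcases Int.even_or_odd ((γ : SL(2, ℤ)) 1 0) with ⟨t, ht⟩ | h
        · exfalso; rw [ha', hb', ht] at hdet
          have : (4 : ℤ) ∣ -2 := ⟨a' * a' + a' + b' * t, by linear_combination -hdet⟩
          omega
        · exact h
      obtain ⟨c', hc'⟩ := hc_odd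
      rw [ha', hb', hc'] at hdet
      rw [hc'] at hNc
      have hdet2 : 2 * a' * a' + 2 * a' + 1 + b' * (2 * c' + 1) = 0 := by linarith [hdet]
      -- fixed translate `γ₁ = δ₁ γ δ₁⁻¹` and conjugator `g = δ₁ (1 + γ)/2`
      obtain ⟨γ₁, e00, e01, e10, e11⟩ := exists_gamma0_entries (N := N) (2 * a' + 1) b' (2 * (2 * c' + 1))
        (-(2 * a' + 1)) (by linear_combination (-1 : ℤ) * hdet) (Dvd.dvd.mul_left hNc 2)
      obtain ⟨g, g00, g01, g10, g11⟩ := exists_gamma0_entries (N := N) (a' + 1) b' (2 * c' + 1) (-(2 * a'))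
        (by linear_combination (-1 : ℤ) * hdet2) hNc
      have hgγ : g * γ = γ₁ * g := by
        apply gamma0_mul_eq_mul_of_entries <;>
          simp only [g00, g01, g10, g11, e00, e01, e10, e11, htr, ha', hb', hc'] <;> ring
      -- the pair
      obtain ⟨p₁, p00, p01, p10, p11⟩ := exists_gamma0_entries (N := N) (a' + c' + 1) (b' + b' - 2 * a' - 1)
        (2 * c' + 1) (-(2 * (2 * a' + 1))) (by linear_combination (-1 : ℤ) * hdet) hNc
      obtain ⟨p₂, q00, q01, q10, q11⟩ := exists_gamma0_entries (N := N) (2 * (2 * a' + 1)) (b' + b' - 2 * a' - 1)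
        (2 * c' + 1) (-(a' + c' + 1)) (by linear_combination (-1 : ℤ) * hdet) hNc
      have hprod : ((p₁ * p₂ : Gamma0 N) : SL(2, ℤ)) 1 0 = 0 := by
        rw [gamma0_mul_apply_one_zero, p10, p11, q00, q10]; ring
      have hv : ((2 * c' + 1 : ℤ) : ℚ) ≠ 0 := by rw [← hc']; exact hcQ
      have E := heckeTwo_apply_eq_maninCusp_add (Φ := Φ)
        ((((γ : SL(2, ℤ)) 0 0 : ℚ)) / (((γ : SL(2, ℤ)) 1 0 : ℚ))) γ₁ p₁ p₂
        (by rw [e10]; omega) (by rw [e00, e10, ha', hc']; push_cast at hv ⊢; field_simp)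
        (by rw [p10]; omega) (by
          rw [p00, p10, ha', hc', div_add_one hv, div_div, div_eq_div_iff hv (mul_ne_zero hv two_ne_zero)]
          push_cast; ring)
        (by rw [q10]; omega) (by rw [q00, q10, ha', hc']; push_cast at hv ⊢; field_simp)
      rw [E, hconj g γ₁ hgγ, if_neg hc0, add_assoc, hpair p₁ p₂ hprod, add_zero]
    · /- Case B2: `b = 2b'+1` odd, `c = 2c'` even (and `N ∣ c'` as `N` is odd). Fixed coset `δ₃` (`↦ 2x`); pair
        `δ₁ γ δ₂⁻¹ ↦ x/2`, `δ₂ γ δ₁⁻¹ ↦ (x+1)/2`. -/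
      have hc_even : Even ((γ : SL(2, ℤ)) 1 0) := by
        rcases Int.even_or_odd ((γ : SL(2, ℤ)) 1 0) with h | ⟨t, ht⟩
        · exact h
        · exfalso; rw [ha', hb', ht] at hdet
          have : (2 : ℤ) ∣ -1 := ⟨2 * a' * a' + 2 * a' + 2 * b' * t + b' + t + 1, by linear_combination -hdet⟩
          omega
      obtain ⟨c', hc'⟩ := hc_even
      rw [ha', hb', hc'] at hdet
      rw [hc'] at hNc
      have hNc' : (N : ℤ) ∣ c' := by
        obtain ⟨k, hk⟩ := hNc
        exact ⟨c' - m * k, by linear_combination (-m) * hk + (-c') * hm⟩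
      have hc'0 : c' ≠ 0 := by rintro rfl; simp at hc'; exact hc0 hc'
      have hdet2 : 2 * a' * a' + 2 * a' + 1 + (2 * b' + 1) * c' = 0 := by linarith [hdet]
      -- fixed translate `γ₃ = δ₃ γ δ₃⁻¹` and conjugator `g = δ₃ (1 + γ)/2`
      obtain ⟨γ₃, e00, e01, e10, e11⟩ := exists_gamma0_entries (N := N) (2 * a' + 1) (2 * (2 * b' + 1)) c'
        (-(2 * a' + 1)) (by linear_combination (-2 : ℤ) * hdet2) hNc'
      obtain ⟨g, g00, g01, g10, g11⟩ := exists_gamma0_entries (N := N) (2 * a' + 2) (2 * b' + 1) c' (-a')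
        (by linear_combination (-1 : ℤ) * hdet2) hNc'
      have hgγ : g * γ = γ₃ * g := by
        apply gamma0_mul_eq_mul_of_entries <;>
          simp only [g00, g01, g10, g11, e00, e01, e10, e11, htr, ha', hb', hc'] <;> ring
      -- the pair
      obtain ⟨p₁, p00, p01, p10, p11⟩ := exists_gamma0_entries (N := N) (2 * a' + 1) (b' - a') (2 * (c' + c'))
        (-(c' + c') - (2 * a' + 1)) (by linear_combination (-1 : ℤ) * hdet) (Dvd.dvd.mul_left hNc 2)
      obtain ⟨p₂, q00, q01, q10, q11⟩ := exists_gamma0_entries (N := N) (2 * a' + 1 + (c' + c')) (b' - a')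
        (2 * (c' + c')) (-(2 * a' + 1)) (by linear_combination (-1 : ℤ) * hdet) (Dvd.dvd.mul_left hNc 2)
      have hprod : ((p₁ * p₂ : Gamma0 N) : SL(2, ℤ)) 1 0 = 0 := by
        rw [gamma0_mul_apply_one_zero, p10, p11, q00, q10]; ring
      have hv : ((c' : ℤ) : ℚ) ≠ 0 := by exact_mod_cast hc'0
      have E := heckeTwo_apply_eq_maninCusp_add (Φ := Φ)
        ((((γ : SL(2, ℤ)) 0 0 : ℚ)) / (((γ : SL(2, ℤ)) 1 0 : ℚ))) p₁ p₂ γ₃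
        (by rw [p10]; omega) (by rw [p00, p10, ha', hc']; push_cast; field_simp)
        (by rw [q10]; omega) (by rw [q00, q10, ha', hc']; push_cast; field_simp)
        (by rw [e10]; exact hc'0) (by rw [e00, e10, ha', hc']; push_cast; field_simp; ring)
      rw [E, hconj g γ₃ hgγ, if_neg hc0, hpair p₁ p₂ hprod, zero_add]

/-- **Exact corollary**: if `T₂Φ = 0` pointwise (e.g. `Φ` valued in a group with `2Φ`-torsion irrelevant and
`T₂`-eigenvalue `a₂ ≡ 0`), the period homomorphism of `Φ` KILLS every trace-zero (order-`4` elliptic) element of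
`Γ₀(N)`, `N` odd: `Φ(a/c) = 0`. [cite: Merel1994, §1.2–1.3] -/
theorem maninCusp_eq_zero_of_trace_zero_of_heckeTwo (hN : Odd N)
    (hM : ∀ (γ : Gamma0 N) (r : ℚ), ((γ : SL(2, ℤ)) 1 0 : ℚ) * r + ((γ : SL(2, ℤ)) 1 1 : ℚ) ≠ 0 →
      Φ ((((γ : SL(2, ℤ)) 0 0 : ℚ) * r + ((γ : SL(2, ℤ)) 0 1 : ℚ)) /
        (((γ : SL(2, ℤ)) 1 0 : ℚ) * r + ((γ : SL(2, ℤ)) 1 1 : ℚ))) =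
        (if ((γ : SL(2, ℤ)) 1 0) = 0 then 0 else Φ ((((γ : SL(2, ℤ)) 0 0 : ℚ)) / (((γ : SL(2, ℤ)) 1 0 : ℚ)))) + Φ r)
    (hT : ∀ x : ℚ, (∑ j : Fin 2, Φ ((x + j) / 2)) + Φ (2 * x) = 0)
    (γ : Gamma0 N) (htr : (γ : SL(2, ℤ)) 1 1 = -((γ : SL(2, ℤ)) 0 0)) :
    Φ ((((γ : SL(2, ℤ)) 0 0 : ℚ)) / (((γ : SL(2, ℤ)) 1 0 : ℚ))) = 0 := by
  rw [← heckeTwo_apply_maninCusp_of_trace_zero hN hM γ htr]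
  exact hT _

/-- **Ultrametric corollary** (the form used for (C3)): over an ultrametric normed ring, if `‖Φ‖ ≤ 1` and `Φ` is
`T₂`-eigen modulo the open unit ball with a NON-UNIT eigenvalue `a` (`‖T₂Φ − aΦ‖ < 1`, `‖a‖ < 1`; e.g. `a = a₂(W)`
for `W` supersingular at `2`), then every cusp value `Φ(γ·∞)` at a trace-zero (order-`4` elliptic) `γ ∈ Γ₀(N)`,
`N` odd, lies in the open unit ball: the period homomorphism of `Φ mod 𝔪` kills the order-`2` elliptic classes.
[cite: Merel1994, §1.2–1.3] -/
theorem norm_maninCusp_lt_one_of_trace_zero {K : Type*} [NormedRing K] [IsUltrametricDist K] (hN : Odd N)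
    (Ψ : ℚ → K) (a : K) (ha : ‖a‖ < 1)
    (hM : ∀ (γ : Gamma0 N) (r : ℚ), ((γ : SL(2, ℤ)) 1 0 : ℚ) * r + ((γ : SL(2, ℤ)) 1 1 : ℚ) ≠ 0 →
      Ψ ((((γ : SL(2, ℤ)) 0 0 : ℚ) * r + ((γ : SL(2, ℤ)) 0 1 : ℚ)) /
        (((γ : SL(2, ℤ)) 1 0 : ℚ) * r + ((γ : SL(2, ℤ)) 1 1 : ℚ))) =
        (if ((γ : SL(2, ℤ)) 1 0) = 0 then 0 else Ψ ((((γ : SL(2, ℤ)) 0 0 : ℚ)) / (((γ : SL(2, ℤ)) 1 0 : ℚ)))) + Ψ r)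
    (hle : ∀ r : ℚ, ‖Ψ r‖ ≤ 1)
    (hT : ∀ x : ℚ, ‖(∑ j : Fin 2, Ψ ((x + j) / 2)) + Ψ (2 * x) - a * Ψ x‖ < 1)
    (γ : Gamma0 N) (htr : (γ : SL(2, ℤ)) 1 1 = -((γ : SL(2, ℤ)) 0 0)) :
    ‖Ψ ((((γ : SL(2, ℤ)) 0 0 : ℚ)) / (((γ : SL(2, ℤ)) 1 0 : ℚ)))‖ < 1 := by
  set x : ℚ := (((γ : SL(2, ℤ)) 0 0 : ℚ)) / (((γ : SL(2, ℤ)) 1 0 : ℚ)) with hx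
  have h1 := hT x
  rw [hx, heckeTwo_apply_maninCusp_of_trace_zero hN hM γ htr, ← hx] at h1
  have h2 : ‖a * Ψ x‖ < 1 :=
    (norm_mul_le _ _).trans_lt (mul_lt_one_of_nonneg_of_lt_one_left (norm_nonneg a) ha (hle x))
  have := IsUltrametricDist.norm_add_le_max (Ψ x - a * Ψ x) (a * Ψ x)
  rw [sub_add_cancel] at this
  exact this.trans_lt (max_lt h1 h2)

end Elliptic

end Summit.BirchSwinnertonDyer.BirchSwinnertonDyer.Theorems.ThetaLayerLambdaCongruenceAtTwo

end
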